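import Summits.HodgeConjecture.HodgeConjecture.Theorems.Ring2BindersLocalVHCAtCMPrimitiveMiddle
import Summits.HodgeConjecture.HodgeConjecture.Theorems.Ring2TransportWeilTypeExactness
import Summits.HodgeConjecture.HodgeConjecture.Theorems.Ring2TransportSemiregularGerm
import Literature.AlgebraicGeometry.HodgeTheory.BlochSemiregularSpread
import Literature.AlgebraicGeometry.HodgeTheory.HodgeTypeConjugation
import HarnessLib

/-!
# HSemireg venture · general structure (G4) — the WIRING, THINNED to fibrewise-primitive MIDDLE classes (the cell where the tables live)

HONEST FRAMING (speculative tier of cell `pub-hsemireg`, team «general structure», seat G4; verbatim the cell's wording rule):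
**nothing here says `HC_AV` or `HC_CM` is proved; every implication carries its named hypotheses.** No `sorry`, no new axiom; axioms
`propext`, `Classical.choice`, `Quot.sound`. `HC_CM` = the OPEN route item `Theses.RankFourFaces.CMAbelianHodge`
(stmt-HodgeConjecture-3052), always a binder; `HC_AV` = `Theses.PadicSemiregularLift.HodgeAbelianVarieties` (stmt-HodgeConjecture-1333).

Companions `GeneralStructureWiring.lean` (sheaf form) and `GeneralStructureWiringBloch.lean` (cycle form) ask the team's «uniform
semiregularity at CM points» at EVERY CM-anchored family and EVERY codimension `p` — in exactly the antecedents of ring 2's CM-germ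
leaf `Ring2.Hypotheses.LocalVHCAtCM`. Ring 2's binder seat proved (`Ring2BindersLocalVHCAtCMPrimitiveMiddle.lean`, modulo Catanese 2002
only) that the leaf IS its part on fibrewise LEFSCHETZ-PRIMITIVE classes of the MIDDLE degree `2p = m ≥ 4`
(`localVHCAtCM_iff_primitiveMiddleFrom_four_of_catanese2002`; the defect induction pads one CM elliptic curve at a time). This file
(request R1 of the deform seat's review `DEFORM-REVIEW-G4.md`, and §3 of the transport seat's `TRANSPORT-INTAKE-G4.md`) thins the
team's hypothesis accordingly, in both forms:

* `UniformSemiregularSheafLiftAtCMPrimitiveMiddle C` / `UniformBlochLiftAtCMPrimitiveMiddle` — the same ∃-packages, demanded ONLY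
  for `m ≥ 4`, `2 ≤ p`, `2p = m`, and `G` fibrewise `K|`-PRIMITIVE for a global class `K` polarising every fibre (exactly the
  antecedents of ring 2's `LocalVHCAtCMPrimitiveMiddleFrom[4]`). GAIN (numbers, not adjectives): the «cheap instances» `p ∈ {0, 1, m}`,
  `G = hᵖ` LEAVE the statement (they are not primitive middle); the team's tables — middle-degree WEIL classes on Weil-type `2n`-folds,
  which ARE `h`-primitive (`h ⌣ w = 0`, tree `cupProduct_eq_zero_of_map_eq_smul_of_mem_weilClassesOf`) — instantiate the hypothesis
  of record LITERALLY (`m = 2n`, `p = n`, `n ≥ 2`). COST: one more refereed named fact on the `HC_AV` rows (Catanese 2002 Thm. 4.1,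
  already consumed by ring 2).
* PM-1 (sheaf) `localVHCAtCMPrimitiveMiddleFrom_four_of_buchweitzFlenner_of_uniformSheafLiftPrimitiveMiddle` and PM-1 (cycle)
  `localVHCAtCMPrimitiveMiddleFrom_four_of_blochSpread_of_catanese_of_uniformBlochLiftPrimitiveMiddle` — proved here (same proofs as
  the companions' G4-1 / B-1, the extra binders being carried, not used);
* PM-2 `hc_av_of_…` — **`HC_AV` modulo (`HC_CM`, Deligne 1982 Prop. 6.1, Catanese 2002, BF 5.1 resp. Bloch 7.4, the THINNED uniform
  lift)**, through ring 2's thinned pivot `hc_av_of_hc_cm_of_cmAnchoredFamilies_of_localVHCAtCMPrimitiveMiddleFrom_four_of_catanese2002`;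
  `↔ HodgeWeilType` by ring 2's exactness; the transport half `CMToAbelian` without `HC_CM`;
* PM-3 `primitiveMiddle_position` — granted Deligne 1982 and Catanese 2002, `CMToAbelian ↔ (HC_CM → LocalVHCAtCMPrimitiveMiddleFrom[4])`
  (ring 2): the thinned lift is a sufficient condition for EXACTLY what `HC_CM` lacks.

HONEST LABEL on both thinned hypotheses: OURS, SPECULATIVE, OPEN; no statement producing a semiregular representative from algebraicity
is in print (Bloch 1972 Thm. 7.1, Buchweitz–Flenner 2003 Thm. 5.1/5.2 and Markman's Question 11.4 sentence 1 have it GIVEN); the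
referee label «plausibly false as a `∀`-statement» (ring 2, ref1 F5) now applies to a `∀` over CM-anchored families of EVEN relative
dimension `≥ 4` and their fibrewise-primitive middle classes only — the report should quote it against THIS form (deform seat, M1).

## References (bib keys)

BuchweitzFlenner2003 (Thm. 5.1, 5.2, Def. 4.1, (8.1), Prop. 8.2), Bloch1972Semiregularity (Thm. 7.1, 7.4), Deligne1982HodgeCycles
(Prop. 6.1, §4), CharlesSchnell2014Notes (Prop. 11.3.11, Thm. 11.5.11), Catanese2002DeformationTypes (§4 Thm. 4.1, 4.6),
VoisinHodgeI2002 (§6.2.3, §9.2.1), VoisinHodgeII2003 (§3.1.2, Thm. 4.18), KerrPearlstein2011 (§3.1), vanGeemen1994HodgeAV (4.9–4.11).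
-/

noncomputable section

open CategoryTheory
open Literature.AlgebraicGeometry Literature.AlgebraicGeometry.Motives
open Literature.AlgebraicGeometry.HodgeTheory
open Literature.AlgebraicGeometry.Deligne1982 (deligne1982_cmDenseMumfordTateFamilies)

namespace Summit.Ventures.HSemireg.GeneralStructure

open Summit.HodgeConjecture.HodgeConjecture
open Summit.HodgeConjecture.HodgeConjecture.Ring2.Hypotheses (CMAnchoredFamilies LocalVHCAtCM
  cmToAbelian_of_cmAnchoredFamilies_of_localVHCAtCM)
open Summit.HodgeConjecture.HodgeConjecture.Ring2.Binders (localVHCAtCM_of_primitiveMiddleFrom_four_of_catanese2002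
  hc_av_of_hc_cm_of_cmAnchoredFamilies_of_localVHCAtCMPrimitiveMiddleFrom_four_of_catanese2002
  cmToAbelian_iff_localVHCAtCMPrimitiveMiddleFrom_four_of_hc_cm_of_deligne1982_of_catanese2002 dim_eq_of_iso_fiberOver)
open Summit.HodgeConjecture.HodgeConjecture.Ring2Transport (HodgeWeilType pathIn transportFun_pathIn_mono
  hodgeAbelianVarieties_iff_hodgeWeilType)

/-! ### §0 The CM-pivot vocabulary and ring 2's primitive-middle restriction (verbatim local notations) -/

/-- `IsCM[A]` — CM type in the eigenvalue typing (verbatim `Ring2HypothesesCMPivot`). Local notation only. -/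
local notation3 (prettyPrint := false) "IsCM[" A "]" =>
  ∃ (ψ : A ⟶ A) (μ : Fin (2 * AbelianVariety.dim A) → ℂ), Function.Injective μ ∧
    ∀ i, Module.End.HasEigenvalue (HodgeTheory.complexBetti.map ψ.hom.hom.hom 1).hom (μ i)

/-- `QProj[X]` — `X` quasi-projective over `ℂ` (inlined body of `HodgeTheory.IsQuasiProjectiveOver X`). Local notation only. -/
local notation3 (prettyPrint := false) "QProj[" X "]" =>
  ∃ (P : SchemeOver ℂ) (j : X ⟶ P), IsProjectiveOver P ∧ AlgebraicGeometry.IsOpenImmersion j.left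

/-- `FibreIncl[f, B, e, s]` — `e` presents `B` as the fibre of `f` over `s`. Local notation only. -/
local notation3 (prettyPrint := false) "FibreIncl[" f ", " B ", " e ", " s "]" =>
  ∃ i : AbelianVariety.X B ≅ fiberOver f s, e = CategoryStruct.comp i.hom (fiberι f s)

/-- `HodgeAlong[S, 𝒳, f, G, p]` — `G` is rational `(p,p)` on every fibre presented as an abelian variety. Local notation only. -/
local notation3 (prettyPrint := false) "HodgeAlong[" S ", " 𝒳 ", " f ", " G ", " p "]" =>
  ∀ (B : AbelianVariety ℂ) (eB : AbelianVariety.X B ⟶ 𝒳) (u : ComplexPoints S),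
    FibreIncl[f, B, eB, u] →
      HodgeTheory.IsRationalClass (HodgeTheory.complexBetti.map eB (2 * p) G) ∧
      HodgeTheory.IsOfHodgeType B.dim B.X (2 * p) p p (HodgeTheory.complexBetti.map eB (2 * p) G)

/-- `LocalVHCAtCMPrimitiveMiddleFrom[g]` — ring 2's row b08 restricted to fibrewise Lefschetz-primitive classes of the middle degree on
families of relative dimension `≥ g` (verbatim `Ring2BindersLocalVHCAtCMPrimitiveMiddle.lean`). Local notation only. -/
local notation3 (prettyPrint := false) "LocalVHCAtCMPrimitiveMiddleFrom[" g "]" =>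
  ∀ (S 𝒳 : SchemeOver ℂ) (f : 𝒳 ⟶ S) (m p : ℕ) (G : HodgeTheory.complexBetti 𝒳 (2 * p))
    (s₀ : ComplexPoints S) (A₀ : AbelianVariety ℂ) (e₀ : A₀.X ⟶ 𝒳),
    g ≤ m → 2 ≤ p → 2 * p = m →
    QProj[𝒳] → QProj[S] → AlgebraicGeometry.Smooth S.hom → IrreducibleSpace S.left →
    IsSmoothProjectiveFamily f m →
    FibreIncl[f, A₀, e₀, s₀] → IsCM[A₀] →
    HodgeTheory.complexBetti.map e₀ (2 * p) G ∈ HodgeTheory.algebraicClasses A₀.X p →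
    HodgeAlong[S, 𝒳, f, G, p] →
    ∀ (K : HodgeTheory.complexBetti 𝒳 2),
      (∀ t : ComplexPoints S,
        HodgeTheory.IsPolarizationClass m (fiberOver f t) (HodgeTheory.complexBetti.map (fiberι f t) 2 K)) →
      (∀ t : ComplexPoints S, HodgeTheory.complexBetti.map (fiberι f t) (2 * p) G ∈
        HodgeTheory.primitiveClasses (HodgeTheory.complexBetti.map (fiberι f t) 2 K) m (2 * p)) →
    ∃ U : Set (ComplexPoints S), IsOpen U ∧ s₀ ∈ U ∧ ∀ t ∈ U,
      HodgeTheory.complexBetti.map (fiberι f t) (2 * p) G ∈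
        HodgeTheory.algebraicClasses (fiberOver f t) p

/-! ### §1 The thinned hypotheses -/

/-- **`UniformSemiregularSheafLiftAtCMPrimitiveMiddle C` — uniform semiregularity at CM points, SHEAF form, asked only for fibrewise
`K|`-PRIMITIVE classes of the MIDDLE degree `2p = m ≥ 4`** (OURS, SPECULATIVE, OPEN — NOT a Literature fact). In exactly the antecedents
of ring 2's `LocalVHCAtCMPrimitiveMiddleFrom[4]` (CM-anchored family of abelian `2p`-folds, `p ≥ 2`, over a smooth irreducible
quasi-projective base; `G` rational `(p,p)` on abelian-presented fibres, ALGEBRAIC on the CM fibre, `K|`-primitive on every fibre for a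
global polarising class `K`): a Euclidean-open `U ∋ s₀`, finitely many finite locally free `E_i` on THE fibre `𝒳_{s₀}`, degree sets
`I_i ∋ p`, `E_i` `I_i`-semiregular (Buchweitz–Flenner), `c_i ∈ ℂ` with `G|_{𝒳_{s₀}} = Σ c_i ch_p(E_i)`, and `ch_q(E_i)`, `q ∈ I_i`, of
type `(q,q)` along paths in `U` — the input package of the tree fact `BuchweitzFlenner2003_variationalHodge_ISemiregular`. The cell the
team's tables instantiate: `m = 2n`, `p = n`, `G` a Weil class (primitive: `h ⌣ w = 0`). HONEST LABEL: plausibly false as a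
`∀`-statement (ring 2, ref1 F5) — over even relative dimension `≥ 4` and primitive middle classes; preferred form = per-family witnesses;
NOT a case of HC; no on-path lemma. NOT asserted. CAVEAT C1 (transport review T-R4, 2026-08-22; numbers, not adjectives): `IsISemiregular` and the tree's
rendering of Buchweitz–Flenner Thm. 5.1 (`BuchweitzFlenner2003_variationalHodge_ISemiregular`) are for FINITE LOCALLY FREE `E_i`
ONLY (gap G44: the coherent-sheaf / perfect-complex versions — BF 2003 for modules, Pridham 2024, Perry 2026 — are not rendered);
ideal sheaves `I_Z`, `I_Z ⊠ I_{Z'}^∨` and secant complexes do NOT instantiate this statement as typed — they need a locally free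
(twisted) replacement, the lci door (`UniformBlochLiftAtCM`, Bloch 7.4), or an explicitly labelled BF-for-complexes binder; never a
hidden conversion. (Docstring revised 2026-08-22, words only, no declaration changed.)
SHADOW AND DOMAIN (RED-GS GS-9 / GS-10 R6, 2026-08-22): (i) restricted to the point base `Spec ℂ` this statement ENTAILS the
deformation-free shadow (★) «every rational algebraic `(p,p)` class on every CM abelian variety is a `ℂ`-combination of `ch_p` of
`I`-semiregular finite locally free sheaves» (for `2p = m ≥ 4`; kernel at the un-thinned level: `existsAnchor_pointBase`, `GeneralStructureWiringFamilies.lean`), which is TRUE FOR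
FREE at divisor-generated CM points such as `E^{2n}` (ample line bundles, hard Lefschetz) — table rows there are NO evidence for (★); its
content is the exceptional classes, `2 ≤ p ≤ m − 2`; (ii) DOMAIN: the `∀` ranges over ALL CM fibres of ALL admissible families (simple CM
points, special sub-families, 0-dimensional bases), while the team's evidence is product CM points, Weil classes, `n ≤ 5`; (iii) HIDDEN
PARAMETER (red-1 V2-L4): the statement and its rows are parametrised by `C : ChernCharacterBetti`, of which the tree vendors NO instance
(a construction-type input of every sheaf row; the cycle form has none). (Docstring revised 2026-08-22, words only.)
[cite: BuchweitzFlenner2003, §5 Thm. 5.1 and Def. 4.1]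
[cite: Bloch1972Semiregularity, Thm. (7.1)] [cite: VoisinHodgeI2002, §6.2.3 (primitive classes)] [status: open, speculative] -/
@[conjecture] def UniformSemiregularSheafLiftAtCMPrimitiveMiddle (C : ChernCharacterBetti) : Prop :=
  ∀ (S 𝒳 : SchemeOver ℂ) (f : 𝒳 ⟶ S) (m p : ℕ) (G : HodgeTheory.complexBetti 𝒳 (2 * p))
    (s₀ : ComplexPoints S) (A₀ : AbelianVariety ℂ) (e₀ : A₀.X ⟶ 𝒳),
    4 ≤ m → 2 ≤ p → 2 * p = m →
    QProj[𝒳] → QProj[S] → AlgebraicGeometry.Smooth S.hom → IrreducibleSpace S.left →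
    IsSmoothProjectiveFamily f m →
    FibreIncl[f, A₀, e₀, s₀] → IsCM[A₀] →
    HodgeTheory.complexBetti.map e₀ (2 * p) G ∈ HodgeTheory.algebraicClasses A₀.X p →
    HodgeAlong[S, 𝒳, f, G, p] →
    ∀ (K : HodgeTheory.complexBetti 𝒳 2),
      (∀ t : ComplexPoints S,
        HodgeTheory.IsPolarizationClass m (fiberOver f t) (HodgeTheory.complexBetti.map (fiberι f t) 2 K)) →
      (∀ t : ComplexPoints S, HodgeTheory.complexBetti.map (fiberι f t) (2 * p) G ∈
        HodgeTheory.primitiveClasses (HodgeTheory.complexBetti.map (fiberι f t) 2 K) m (2 * p)) →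
    ∃ (U : Set (ComplexPoints S)) (hs₀ : s₀ ∈ U), IsOpen U ∧
      ∃ (r : ℕ) (c : Fin r → ℂ) (E : Fin r → (fiberOver f s₀).left.Modules)
        (hE : ∀ i, IsFiniteLocallyFree (E i)) (Ideg : Fin r → Finset ℕ),
        (∀ i, p ∈ Ideg i) ∧ (∀ i, IsISemiregular (hE i) {q | q + 1 ∈ Ideg i}) ∧
        complexBetti.map (fiberι f s₀) (2 * p) G = ∑ i, c i • C.ch (fiberOver f s₀) (E i) p ∧
        ∀ (hU : IsCohomologicallyLocallyTrivialOn f U) (i : Fin r), ∀ q ∈ Ideg i,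
          ∀ (t : U) (γ : Path.Homotopic.Quotient (⟨s₀, hs₀⟩ : U) t),
            IsOfHodgeType m (fiberOver f t.1) (2 * q) q q
              (transportFun f (2 * q) hU γ (C.ch (fiberOver f s₀) (E i) q))

/-- **`UniformBlochLiftAtCMPrimitiveMiddle` — uniform semiregularity at CM points, CYCLE form, asked only for fibrewise `K|`-PRIMITIVE
classes of the MIDDLE degree `2p = m ≥ 4`** (OURS, SPECULATIVE, OPEN — NOT a Literature fact). In the same antecedents: a global class
`H` rational and algebraic on every fibre with `(G - H)|_{A₀} = 0` or `(G - H)|_{A₀}` supported on ONE integral Bloch-semiregular lci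
`Z ↪ A₀` of codimension `p` — the input of the tree fact `BlochSemiregularSpread m p` at the anchor (seed shape `[Z] = q·hᵖ + w`).
NOT asserted.
POSITION (RED-GS GS-14, 2026-08-22, kernel: `uniformBlochLift_sandwich`, `uniformBlochLiftAtCMPrimitiveMiddle_of_hc_av_of_catanese` in
`GeneralStructureWiringConverses.lean`): this statement is IMPLIED by `HC_AV` (+ Catanese 2002) through the free correction `H := G`
(`blochLift_conclusion_of_fibrewise_algebraic`), and implies `CMToAbelian` modulo {anchors, Bloch 7.4, Catanese} — it sits BETWEEN
`CMToAbelian` (stmt-16267) and `HC_AV`; modulo {Deligne 1982 Prop. 6.1, Bloch 7.4, Catanese} `HC_CM ∧ UniformBlochLiftAtCM ↔ HC_AV` (the thinned form included).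
Its content is the TRANSPORT of algebraicity from the CM fibre along the component; a semiregular representative is a proof strategy for an
instance, not something the hypothesis asserts. A CASE of the summit (on-path: `uniformBlochLift_position`).
The referee label «plausibly false as a `∀`-statement» (ring 2, ref1 F5) does NOT apply to the cycle forms (refuting this statement would refute
`HC_AV` modulo Catanese); it applies to the SHEAF forms only. (Docstring revised 2026-08-22, words only, no declaration changed.)
[cite: Bloch1972Semiregularity, Thm. (7.1) and (7.4)]
[cite: BuchweitzFlenner2003, Thm. 5.2, (8.1) and Prop. 8.2] [status: open] -/
@[conjecture] def UniformBlochLiftAtCMPrimitiveMiddle : Prop :=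
  ∀ (S 𝒳 : SchemeOver ℂ) (f : 𝒳 ⟶ S) (m p : ℕ) (G : HodgeTheory.complexBetti 𝒳 (2 * p))
    (s₀ : ComplexPoints S) (A₀ : AbelianVariety ℂ) (e₀ : A₀.X ⟶ 𝒳),
    4 ≤ m → 2 ≤ p → 2 * p = m →
    QProj[𝒳] → QProj[S] → AlgebraicGeometry.Smooth S.hom → IrreducibleSpace S.left →
    IsSmoothProjectiveFamily f m →
    FibreIncl[f, A₀, e₀, s₀] → IsCM[A₀] →
    HodgeTheory.complexBetti.map e₀ (2 * p) G ∈ HodgeTheory.algebraicClasses A₀.X p →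
    HodgeAlong[S, 𝒳, f, G, p] →
    ∀ (K : HodgeTheory.complexBetti 𝒳 2),
      (∀ t : ComplexPoints S,
        HodgeTheory.IsPolarizationClass m (fiberOver f t) (HodgeTheory.complexBetti.map (fiberι f t) 2 K)) →
      (∀ t : ComplexPoints S, HodgeTheory.complexBetti.map (fiberι f t) (2 * p) G ∈
        HodgeTheory.primitiveClasses (HodgeTheory.complexBetti.map (fiberι f t) 2 K) m (2 * p)) →
    ∃ H : HodgeTheory.complexBetti 𝒳 (2 * p),
      (∀ t : ComplexPoints S, IsRationalClass (complexBetti.map (fiberι f t) (2 * p) H) ∧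
        complexBetti.map (fiberι f t) (2 * p) H ∈ algebraicClasses (fiberOver f t) p) ∧
      (complexBetti.map e₀ (2 * p) (G - H) = 0 ∨
        ∃ (Z : AlgebraicGeometry.Scheme.{0}) (i : Z ⟶ A₀.X.left),
          AlgebraicGeometry.IsClosedImmersion i ∧ IsRegularImmersionOfCodim i p ∧
          AlgebraicGeometry.IsIntegral Z ∧ (∀ z ∈ Set.range i.base, (p : ℕ∞) ≤ Order.coheight z) ∧
          IsBlochSemiregular i m p ∧
          complexBetti.map e₀ (2 * p) (G - H) ∈ classesSupportedOn A₀.X (Set.range i.base) (2 * p))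

/-! ### §2 Rows PM-1: the refereed transfer theorems land the thinned lifts in ring 2's thinned germ leaf -/

/-- **PM-1 (sheaf) — `LocalVHCAtCMPrimitiveMiddleFrom[4]` from the thinned sheaf lift and Buchweitz–Flenner Thm. 5.1** (kernel-checked;
no `HC_CM`, no Catanese, no preprint; the primitive/middle binders are carried, not used). Proof = the companion file's G4-1.
[cite: BuchweitzFlenner2003, §5 Thm. 5.1] [cite: VoisinHodgeI2002, §9.2.1] [cite: VoisinHodgeII2003, §3.1.2] -/
theorem localVHCAtCMPrimitiveMiddleFrom_four_of_buchweitzFlenner_of_uniformSheafLiftPrimitiveMiddle (C : ChernCharacterBetti)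
    (hBF : BuchweitzFlenner2003_variationalHodge_ISemiregular)
    (hL : UniformSemiregularSheafLiftAtCMPrimitiveMiddle C) : LocalVHCAtCMPrimitiveMiddleFrom[4] := by
  intro S 𝒳 f m p G s₀ A₀ e₀ h4 h2 hpm h𝒳 hS hsm hirr hf hA₀ hCM halg hG K hK hprim
  obtain ⟨U, hs₀U, hUo, r, c, E, hE, Ideg, hpI, hsr, hsum, hHodge⟩ :=
    hL S 𝒳 f m p G s₀ A₀ e₀ h4 h2 hpm h𝒳 hS hsm hirr hf hA₀ hCM halg hG K hK hprim
  have hqS : IsQuasiProjectiveOver S := hS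
  have hU : IsCohomologicallyLocallyTrivialOn f U :=
    (isCohomologicallyLocallyTrivialOn_univ_of_isQuasiProjectiveOver f hf hqS hsm).mono (Set.subset_univ U) hUo
  have hBFi : ∀ i : Fin r, ∃ (Wi : Set (ComplexPoints S)) (hWo : IsOpen Wi) (hW₀ : s₀ ∈ Wi) (hWU : Wi ⊆ U),
      ∀ (t : Wi) (γ : Path.Homotopic.Quotient (⟨s₀, hW₀⟩ : Wi) t),
        transportFun f (2 * p) (hU.mono hWU hWo) γ (C.ch (fiberOver f s₀) (E i) p) ∈
          algebraicClasses (fiberOver f t.1) p := by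
    intro i
    obtain ⟨Wi, hWo, hW₀, hWU, h⟩ := hBF C f m hf hsm hU ⟨s₀, hs₀U⟩ (E i) (hE i) (Ideg i) (hsr i)
      (fun q hq t γ ↦ hHodge hU i q hq t γ)
    exact ⟨Wi, hWo, hW₀, hWU, fun t γ ↦ h p (hpI i) t γ⟩
  choose Wi hWio hW₀i hWiU hWialg using hBFi
  haveI := hsm
  haveI : LocallyPathConnectedSpace (ComplexPoints S) := locallyPathConnectedSpace_complexPoints_of_smooth S
  set W₀ : Set (ComplexPoints S) := U ∩ ⋂ i, Wi i with hW₀def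
  have hW₀o : IsOpen W₀ := hUo.inter (isOpen_iInter_of_finite hWio)
  have hs₀W₀ : s₀ ∈ W₀ := ⟨hs₀U, Set.mem_iInter.2 hW₀i⟩
  refine ⟨pathComponentIn W₀ s₀, hW₀o.pathComponentIn s₀, mem_pathComponentIn_self hs₀W₀, fun t ht ↦ ?_⟩
  have hJ : JoinedIn W₀ s₀ t := ht
  set γ₀ : Path s₀ t := hJ.somePath
  have hγ : ∀ ρ, γ₀ ρ ∈ W₀ := hJ.somePath_mem
  have hγU : ∀ ρ, γ₀ ρ ∈ U := fun ρ ↦ (hγ ρ).1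
  have hγi : ∀ i ρ, γ₀ ρ ∈ Wi i := fun i ρ ↦ Set.mem_iInter.1 (hγ ρ).2 i
  have hGt : complexBetti.map (fiberι f t) (2 * p) G =
      transportFun f (2 * p) hU ⟦pathIn γ₀ U hγU⟧ (complexBetti.map (fiberι f s₀) (2 * p) G) :=
    (transportFun_map_fiberι f (2 * p) hU ⟦pathIn γ₀ U hγU⟧ G).symm
  have hlin : transportFun f (2 * p) hU ⟦pathIn γ₀ U hγU⟧ (∑ i, c i • C.ch (fiberOver f s₀) (E i) p) =
      ∑ i, c i • transportFun f (2 * p) hU ⟦pathIn γ₀ U hγU⟧ (C.ch (fiberOver f s₀) (E i) p) := by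
    simp only [← transportLinear_apply, map_sum, map_smul]
  rw [hGt, hsum, hlin]
  refine Submodule.sum_mem _ fun i _ ↦ Submodule.smul_mem _ (c i) ?_
  have hi := hWialg i ⟨t, hγi i 1 |> fun h ↦ γ₀.target ▸ h⟩ ⟦pathIn γ₀ (Wi i) (hγi i)⟧
  rw [transportFun_pathIn_mono f (2 * p) hU (hWiU i) (hWio i) γ₀ (hγi i)] at hi
  exact hi

/-- **PM-1 (cycle) — `LocalVHCAtCMPrimitiveMiddleFrom[4]` from the thinned Bloch lift, Bloch's theorem (class form) and Catanese's
theorem** (kernel-checked; no `HC_CM`, no preprint). Proof = the companion file's B-1. [cite: Bloch1972Semiregularity, Thm. (7.4)]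
[cite: BuchweitzFlenner2003, Thm. 5.2] [cite: Catanese2002DeformationTypes, §4 Thm. 4.1 and Thm. 4.6] [cite: VoisinHodgeII2003, §3.1.2] -/
theorem localVHCAtCMPrimitiveMiddleFrom_four_of_blochSpread_of_catanese_of_uniformBlochLiftPrimitiveMiddle
    (hB : ∀ m p : ℕ, BlochSemiregularSpread m p) (hC : catanese2002_abelianFibres_of_abelianFibre)
    (hL : UniformBlochLiftAtCMPrimitiveMiddle) : LocalVHCAtCMPrimitiveMiddleFrom[4] := by
  intro S 𝒳 f m p G s₀ A₀ e₀ h4 h2 hpm h𝒳 hS hsm hirr hf hA₀ hCM halg hG K hK hprim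
  obtain ⟨H, hH, hcase⟩ := hL S 𝒳 f m p G s₀ A₀ e₀ h4 h2 hpm h𝒳 hS hsm hirr hf hA₀ hCM halg hG K hK hprim
  obtain ⟨i₀, hi₀⟩ := hA₀
  have hq𝒳 : IsQuasiProjectiveOver 𝒳 := h𝒳
  have hqS : IsQuasiProjectiveOver S := hS
  have hdim : A₀.dim = m := dim_eq_of_iso_fiberOver hf i₀
  have hfam : IsSmoothProjectiveFamily f A₀.dim := hdim ▸ hf
  have hWfib : ∀ s : ComplexPoints S,
      IsRationalClass (complexBetti.map (fiberι f s) (2 * p) (G - H)) ∧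
        IsOfHodgeType m (fiberOver f s) (2 * p) p p (complexBetti.map (fiberι f s) (2 * p) (G - H)) := by
    intro s
    obtain ⟨B, -, ⟨iB⟩⟩ := hC f A₀ hq𝒳 hqS hirr hsm hfam ⟨s₀, ⟨i₀⟩⟩ s
    have h := hG B (iB.hom ≫ fiberι f s) s ⟨iB, rfl⟩
    have he : complexBetti.map (iB.hom ≫ fiberι f s) (2 * p) G =
        complexBetti.map iB.hom (2 * p) (complexBetti.map (fiberι f s) (2 * p) G) := by
      rw [complexBetti.map_comp]
      rfl
    rw [he] at h
    have hBdim : B.dim = m := dim_eq_of_iso_fiberOver hf iB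
    have hX : IsSmoothProjective m (fiberOver f s) := hf.isSmoothProjective s
    have hGs : IsRationalClass (complexBetti.map (fiberι f s) (2 * p) G) ∧
        IsOfHodgeType m (fiberOver f s) (2 * p) p p (complexBetti.map (fiberι f s) (2 * p) G) :=
      ⟨(isRationalClass_map_iff_of_iso iB).1 h.1, hBdim ▸ (isOfHodgeType_map_iff_of_iso iB).1 h.2⟩
    have hHs := hH s
    rw [map_sub]
    refine ⟨?_, hGs.2.sub hX (isOfHodgeType_of_mem_algebraicClasses_of_isSmoothProjective hX p hHs.2)⟩
    have hr := hGs.1.add (hHs.1.smul (-1 : ℚ))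
    rwa [Rat.cast_neg, Rat.cast_one, neg_one_smul, ← sub_eq_add_neg] at hr
  have hsplit : ∀ t : ComplexPoints S, complexBetti.map (fiberι f t) (2 * p) G =
      complexBetti.map (fiberι f t) (2 * p) (G - H) + complexBetti.map (fiberι f t) (2 * p) H := by
    intro t
    rw [map_sub, sub_add_cancel]
  have he₀ : complexBetti.map i₀.hom (2 * p) (complexBetti.map (fiberι f s₀) (2 * p) (G - H)) =
      complexBetti.map e₀ (2 * p) (G - H) := by
    rw [hi₀, complexBetti.map_comp]
    rfl
  rcases hcase with h0 | ⟨Z, i, hci, hreg, hint, hcoh, hsr, hsupp⟩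
  · have h0' : complexBetti.map (fiberι f s₀) (2 * p) (G - H) = 0 := by
      apply (complexBetti.bijective_map_of_iso i₀ (2 * p)).1
      rw [he₀, h0, map_zero]
    have hU : IsCohomologicallyLocallyTrivialOn f (Set.univ : Set (ComplexPoints S)) :=
      isCohomologicallyLocallyTrivialOn_univ_of_isQuasiProjectiveOver f hf hqS hsm
    haveI := hsm
    haveI : LocallyPathConnectedSpace (ComplexPoints S) := locallyPathConnectedSpace_complexPoints_of_smooth S
    refine ⟨pathComponentIn Set.univ s₀, isOpen_univ.pathComponentIn s₀,
      mem_pathComponentIn_self (Set.mem_univ _), fun t ht ↦ ?_⟩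
    have hJ : JoinedIn Set.univ s₀ t := ht
    set γ₀ : Path s₀ t := hJ.somePath
    have hγ : ∀ ρ, γ₀ ρ ∈ (Set.univ : Set (ComplexPoints S)) := fun _ ↦ Set.mem_univ _
    have hGt : complexBetti.map (fiberι f t) (2 * p) (G - H) =
        transportFun f (2 * p) hU ⟦pathIn γ₀ Set.univ hγ⟧ (complexBetti.map (fiberι f s₀) (2 * p) (G - H)) :=
      (transportFun_map_fiberι f (2 * p) hU ⟦pathIn γ₀ Set.univ hγ⟧ (G - H)).symm
    rw [hsplit t, hGt, h0', ← transportLinear_apply, map_zero, zero_add]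
    exact (hH t).2
  · obtain ⟨U, hUo, hs₀U, hU⟩ := hB m p A₀.X Z i (complexBetti.map e₀ (2 * p) (G - H)) 𝒳 S f s₀ i₀ (G - H)
      hci hreg hint hcoh hsr hsupp hf hq𝒳 hqS hsm hWfib he₀
    refine ⟨U, hUo, hs₀U, fun t ht ↦ ?_⟩
    rw [hsplit t]
    exact Submodule.add_mem _ (hU t ht) (hH t).2

/-! ### §3 Rows PM-2: the end statement reads `HC_AV` (equivalently `HodgeWeilType`) modulo named hypotheses, thinned -/

/-- **PM-2 (sheaf) — `HC_CM ∧ [Deligne 1982 Prop. 6.1] ∧ [Catanese 2002] ∧ [Buchweitz–Flenner 5.1] ∧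
UniformSemiregularSheafLiftAtCMPrimitiveMiddle ⟹ HC_AV`**, through ring 2's thinned CM pivot. THE END STATEMENT of seat G4 with the
hypothesis of record thinned to the cell the tables live in. `HC_CM` load-bearing, consumed once.
[cite: Deligne1982HodgeCycles, Prop. 6.1] [cite: Catanese2002DeformationTypes, §4 Thm. 4.1] [cite: BuchweitzFlenner2003, §5 Thm. 5.1]
[cite: CharlesSchnell2014Notes, Prop. 11.3.11 (proof) and Thm. 11.5.11] -/
theorem hc_av_of_hc_cm_of_deligne1982_of_catanese_of_buchweitzFlenner_of_uniformSheafLiftPrimitiveMiddle (C : ChernCharacterBetti)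
    (hCM : Theses.RankFourFaces.CMAbelianHodge) (hD : deligne1982_cmDenseMumfordTateFamilies)
    (hC : catanese2002_abelianFibres_of_abelianFibre) (hBF : BuchweitzFlenner2003_variationalHodge_ISemiregular)
    (hL : UniformSemiregularSheafLiftAtCMPrimitiveMiddle C) : Theses.PadicSemiregularLift.HodgeAbelianVarieties :=
  hc_av_of_hc_cm_of_cmAnchoredFamilies_of_localVHCAtCMPrimitiveMiddleFrom_four_of_catanese2002 hC hCM
    (Ring2.Deform.cmAnchoredFamilies_of_deligne1982 hD)
    (localVHCAtCMPrimitiveMiddleFrom_four_of_buchweitzFlenner_of_uniformSheafLiftPrimitiveMiddle C hBF hL)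

/-- **PM-2 (cycle) — `HC_CM ∧ [Deligne 1982] ∧ [Catanese 2002] ∧ [Bloch 7.4 / BF 5.2] ∧ UniformBlochLiftAtCMPrimitiveMiddle ⟹ HC_AV`.**
[cite: Deligne1982HodgeCycles, Prop. 6.1] [cite: Catanese2002DeformationTypes, §4 Thm. 4.1] [cite: Bloch1972Semiregularity, Thm. (7.4)] -/
theorem hc_av_of_hc_cm_of_deligne1982_of_catanese_of_blochSpread_of_uniformBlochLiftPrimitiveMiddle
    (hCM : Theses.RankFourFaces.CMAbelianHodge) (hD : deligne1982_cmDenseMumfordTateFamilies)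
    (hC : catanese2002_abelianFibres_of_abelianFibre) (hB : ∀ m p : ℕ, BlochSemiregularSpread m p)
    (hL : UniformBlochLiftAtCMPrimitiveMiddle) : Theses.PadicSemiregularLift.HodgeAbelianVarieties :=
  hc_av_of_hc_cm_of_cmAnchoredFamilies_of_localVHCAtCMPrimitiveMiddleFrom_four_of_catanese2002 hC hCM
    (Ring2.Deform.cmAnchoredFamilies_of_deligne1982 hD)
    (localVHCAtCMPrimitiveMiddleFrom_four_of_blochSpread_of_catanese_of_uniformBlochLiftPrimitiveMiddle hB hC hL)

/-- **… `↔ HodgeWeilType`** (ring 2's exactness): the thinned sheaf bundle gives the Hodge conjecture for every abelian variety of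
Weil type — which IS `HC_AV`. [cite: Deligne1982HodgeCycles, §4 Lemma 4.5 and Remark 4.10] [cite: BuchweitzFlenner2003, §5 Thm. 5.1] -/
theorem hodgeWeilType_of_hc_cm_of_deligne1982_of_catanese_of_buchweitzFlenner_of_uniformSheafLiftPrimitiveMiddle
    (C : ChernCharacterBetti) (hCM : Theses.RankFourFaces.CMAbelianHodge) (hD : deligne1982_cmDenseMumfordTateFamilies)
    (hC : catanese2002_abelianFibres_of_abelianFibre) (hBF : BuchweitzFlenner2003_variationalHodge_ISemiregular)
    (hL : UniformSemiregularSheafLiftAtCMPrimitiveMiddle C) : HodgeWeilType :=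
  hodgeAbelianVarieties_iff_hodgeWeilType.1
    (hc_av_of_hc_cm_of_deligne1982_of_catanese_of_buchweitzFlenner_of_uniformSheafLiftPrimitiveMiddle C hCM hD hC hBF hL)

/-- **The transport half, thinned, no `HC_CM`**: `CMAnchoredFamilies ∧ [Catanese] ∧ [BF 5.1] ∧ thinned sheaf lift ⟹ CMToAbelian`
(stmt-HodgeConjecture-16267). [cite: Deligne1982HodgeCycles, Prop. 6.1] [cite: BuchweitzFlenner2003, §5 Thm. 5.1] -/
theorem cmToAbelian_of_cmAnchoredFamilies_of_catanese_of_buchweitzFlenner_of_uniformSheafLiftPrimitiveMiddle (C : ChernCharacterBetti)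
    (hMT : CMAnchoredFamilies) (hC : catanese2002_abelianFibres_of_abelianFibre)
    (hBF : BuchweitzFlenner2003_variationalHodge_ISemiregular) (hL : UniformSemiregularSheafLiftAtCMPrimitiveMiddle C) :
    Theses.RankFourFaces.CMToAbelian :=
  cmToAbelian_of_cmAnchoredFamilies_of_localVHCAtCM hMT (localVHCAtCM_of_primitiveMiddleFrom_four_of_catanese2002 hC
    (localVHCAtCMPrimitiveMiddleFrom_four_of_buchweitzFlenner_of_uniformSheafLiftPrimitiveMiddle C hBF hL))

/-! ### §4 Position -/

/-- **PM-3 — POSITION of the thinned hypotheses (conjunction of tree theorems).** (a) thinned sheaf lift + BF 5.1 ⟹ ring 2's thinned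
germ leaf; (b) thinned cycle lift + Bloch 7.4 + Catanese ⟹ the same; (c) granted Deligne 1982 Prop. 6.1 and Catanese 2002 the thinned
leaf is EXACTLY what `HC_CM` lacks: `CMToAbelian ↔ (HC_CM → LocalVHCAtCMPrimitiveMiddleFrom[4])`; (d) `HC_AV ↔ HodgeWeilType`.
[cite: Deligne1982HodgeCycles, Prop. 6.1 and §4] [cite: Catanese2002DeformationTypes, §4 Thm. 4.1 and Thm. 4.6]
[cite: BuchweitzFlenner2003, §5 Thm. 5.1 and Thm. 5.2] -/
theorem primitiveMiddle_position (C : ChernCharacterBetti) :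
    (BuchweitzFlenner2003_variationalHodge_ISemiregular → UniformSemiregularSheafLiftAtCMPrimitiveMiddle C →
      LocalVHCAtCMPrimitiveMiddleFrom[4]) ∧
    ((∀ m p : ℕ, BlochSemiregularSpread m p) → catanese2002_abelianFibres_of_abelianFibre →
      UniformBlochLiftAtCMPrimitiveMiddle → LocalVHCAtCMPrimitiveMiddleFrom[4]) ∧
    (deligne1982_cmDenseMumfordTateFamilies → catanese2002_abelianFibres_of_abelianFibre →
      (Theses.RankFourFaces.CMToAbelian ↔ (Theses.RankFourFaces.CMAbelianHodge → LocalVHCAtCMPrimitiveMiddleFrom[4]))) ∧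
    (Theses.PadicSemiregularLift.HodgeAbelianVarieties ↔ HodgeWeilType) :=
  ⟨localVHCAtCMPrimitiveMiddleFrom_four_of_buchweitzFlenner_of_uniformSheafLiftPrimitiveMiddle C,
    localVHCAtCMPrimitiveMiddleFrom_four_of_blochSpread_of_catanese_of_uniformBlochLiftPrimitiveMiddle,
    cmToAbelian_iff_localVHCAtCMPrimitiveMiddleFrom_four_of_hc_cm_of_deligne1982_of_catanese2002,
    hodgeAbelianVarieties_iff_hodgeWeilType⟩

/-! ## Audit: nothing is decided here

Every theorem above whose conclusion is `HC_AV`, `HodgeWeilType`, `CMToAbelian` or the thinned germ leaf has among its hypotheses one of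
the team's OPEN, SPECULATIVE thinned lifts together with named printed facts (Deligne 1982 Prop. 6.1 or `CMAnchoredFamilies`; Catanese
2002; Buchweitz–Flenner 5.1 or `BlochSemiregularSpread`) and — where load-bearing — `HC_CM` by name; or it is a conjunction of tree
theorems. Axiom closures: the three standard axioms only. -/

#print axioms Summit.Ventures.HSemireg.GeneralStructure.localVHCAtCMPrimitiveMiddleFrom_four_of_buchweitzFlenner_of_uniformSheafLiftPrimitiveMiddle
#print axioms Summit.Ventures.HSemireg.GeneralStructure.localVHCAtCMPrimitiveMiddleFrom_four_of_blochSpread_of_catanese_of_uniformBlochLiftPrimitiveMiddle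
#print axioms Summit.Ventures.HSemireg.GeneralStructure.hc_av_of_hc_cm_of_deligne1982_of_catanese_of_buchweitzFlenner_of_uniformSheafLiftPrimitiveMiddle

end Summit.Ventures.HSemireg.GeneralStructure

end
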